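import Literature.AlgebraicGeometry.Hironaka2017.S01Introduction.R020bMainTheoremIntro
import Literature.Barriers.ResolutionOfSingularities.InseparableBaseChange
import Literature.AlgebraicGeometry.Resolution.PrincipalizationToResolution
import Literature.AlgebraicGeometry.Motives.VarietiesGeometricallyIntegralProofs
import Mathlib.AlgebraicGeometry.Morphisms.ClosedImmersion
import Mathlib.AlgebraicGeometry.Morphisms.Smooth
import Mathlib.RingTheory.RingHom.Smooth
import HarnessLib

/-!
# Barrier: smooth versus regular blow-up centres over an imperfect base field — on `𝔸¹_{𝔽_p(t)}` the fat point
# `V((x^p − t)²)` is singular, yet no closed subscheme supported at `(x^p − t)` is smooth over `𝔽_p(t)`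

Barrier catalogue entry (D-0021) for the summit `ResolutionOfSingularities`, companion of `InseparableBaseChange.lean`
(same directory), whose algebra (`K(t^{1/p}) ⊗_K K(t^{1/p})` is not reduced, Liu 2002 Ex. 3.2.12) it turns into a
scheme-level statement about BLOW-UP CENTRES: an embedded-resolution format over an arbitrary base field `K` whose
centres must be closed subschemes SMOOTH OVER `K` inside the singular locus has no admissible first centre for
`X = V((x^p − t)²) ⊂ 𝔸¹_K`, `K = 𝔽_p(t)`, while `X` is not regular. Everything is PROVED: `SmoothVsRegularImperfectBase`.

## Sources (the same page-checked locators as the companion entry `InseparableBaseChange`)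

Liu, *Algebraic Geometry and Arithmetic Curves* (2002): Example 3.2.12 («`X` is reduced but not geometrically reduced,
because `X_K = Spec(K ⊗ₖ K)` is not reduced»), Cor. 4.3.33 (perfect field: smooth ⇔ regular), Remark 4.3.34
(«`ℙ¹_{k'}` is a regular algebraic variety over `k`, but it is not smooth over `k`») [cite: Liu2002, Example 3.2.12,
Cor. 4.3.33, Remark 4.3.34]; Stacks Project Tag 056T (smooth over a field ⇒ geometrically regular ⇒ reduced), used
through the tree theorem `Literature.AlgebraicGeometry.Motives.isReduced_of_smooth_of_field` [cite: StacksProject, Tag 056T].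

## Application recorded here (cell res-hironaka, D-0089; HONEST FRAMING)

H. Hironaka, *Resolution of singularities in positive characteristics*, ms. 2017 [Hironaka2017] is an UNREFEREED
MANUSCRIPT UNDER ADJUDICATION (D-0012); its statements are typed as CANDIDATES, never asserted. Row 020 typed the
introduction sentence p.3 l.4–7 AS PRINTED («over any base field 𝕂») as `S01Introduction.MainClaimAsPrinted`, with the
printed ERS format p.3 l.10–19 (`IsERSSequence`: centres with irreducible support, smooth over `K`, inside
`singularLocusOf`; `IsERS`: final strict transform regular). §3 proves `¬ MainClaimAsPrinted.{0}` from the barrier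
(artefact A-46-1 of GAP-LEDGER row R46; verdict class SCOPE, director-resolution 2026-08-26T20:47:59Z: «the
Introduction's scope sentence over-states the body's standing convention (smooth vs regular over imperfect fields); not
a defect of the mathematics under its convention»). The body's standing convention §2 p.4 l.22–24 is `K` PERFECT
(`MainClaimPerfect`), under which this witness does not exist. Nothing here is a claim about resolution of
singularities in characteristic `p`. NOT here (rev. 1): the reduced companion witness `V(y(y − x^p + t)) ⊂ 𝔸²_K`
(«algebraic variety» reading) and a universe-polymorphic form of §3 (the `Type 0` instance is refuted).
-/

noncomputable section

set_option backward.isDefEq.respectTransparency false -- as in Mathlib's IdealSheaf/Subscheme.lean: `Γ(·, ⊤)` of subschemes under `rw`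

open CategoryTheory AlgebraicGeometry TopologicalSpace Polynomial
open scoped TensorProduct

namespace Literature.Barriers.ResolutionOfSingularities

open Literature.AlgebraicGeometry.Resolution

universe u

/-! ## 1. The witness: `K = 𝔽_p(t)`, `Z = 𝔸¹_K = Spec K[x]`, `X = V((x^p − t)²)`, `P = (x^p − t)` -/

section Witness

variable (p : ℕ) [hp : Fact p.Prime]

/-- The coordinate ring `K[x]` of the affine line over `K = 𝔽_p(t)` (`baseField p`). [folklore] -/
abbrev lineRing : Type := (baseField p)[X]

/-- `K[x]` as a bundled commutative ring. [folklore] -/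
abbrev lineRingCat : CommRingCat.{0} := CommRingCat.of (lineRing p)

/-- The ambient scheme `Z = 𝔸¹_K = Spec K[x]`. [folklore] -/
abbrev line : Scheme.{0} := Spec (lineRingCat p)

/-- The structure morphism `Z = Spec K[x] → Spec K`. [folklore] -/
abbrev lineToBase : line p ⟶ Spec (.of (baseField p)) :=
  Spec.map (CommRingCat.ofHom (algebraMap (baseField p) (lineRing p)))

/-- `𝔸¹_K` is irreducible (`K[x]` is a domain). [folklore] -/
instance irreducibleSpace_line : IrreducibleSpace (line p) := PrimeSpectrum.irreducibleSpace

/-- `K[x]` is a smooth `K`-algebra. [folklore] -/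
instance smooth_lineRing : Algebra.Smooth (baseField p) (lineRing p) :=
  haveI : Algebra.Smooth (baseField p) (MvPolynomial (Fin 1) (baseField p)) := {}
  Algebra.Smooth.of_equiv (MvPolynomial.uniqueAlgEquiv (baseField p) (Fin 1))

/-- `𝔸¹_K → Spec K` is smooth (and quasi-compact, an instance found by `inferInstance`). [folklore] -/
instance smooth_lineToBase : Smooth (lineToBase p) := by
  rw [HasRingHomProperty.Spec_iff (P := @Smooth)]
  show RingHom.Smooth (algebraMap (baseField p) (lineRing p))
  rw [RingHom.smooth_algebraMap]
  infer_instance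

/-- `q = x^p − t` (`insepPoly p` of the companion entry). [folklore] -/
abbrev qPoly : lineRing p := insepPoly p

/-- The closed point `P = (x^p − t)` of `𝔸¹_K`, with residue field `K(t^{1/p})`. [folklore] -/
def insepPoint : line p := (⟨Ideal.span {qPoly p}, (PrincipalIdealRing.isMaximal_of_irreducible
    (irreducible_insepPoly p)).isPrime⟩ : PrimeSpectrum (lineRing p))

/-- The ring isomorphism `K[x] ≅ Γ(Z, ⊤)` (inverse of Mathlib's `Scheme.ΓSpecIso`). [folklore] -/
def ΓIso : lineRing p ≃+* Γ(line p, ⊤) := (Scheme.ΓSpecIso (lineRingCat p)).commRingCatIsoToRingEquiv.symm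

/-- `ΓIso⁻¹` is Mathlib's `(ΓSpecIso).hom`. [folklore] -/
private lemma ΓIso_symm_apply (r : Γ(line p, ⊤)) : (ΓIso p).symm r = (Scheme.ΓSpecIso (lineRingCat p)).hom r := rfl
/-- `ΓIso⁻¹ ∘ (ΓSpecIso).inv = id` on `K[x]`. [folklore] -/
@[simp] private lemma ΓIso_symm_inv_apply (r : lineRing p) :
    (ΓIso p).symm ((Scheme.ΓSpecIso (lineRingCat p)).inv r) = r := by
  rw [ΓIso_symm_apply]; exact CategoryTheory.Iso.inv_hom_id_apply _ _

/-- The ideal `((x^p − t)²) ⊂ Γ(Z, ⊤)` (transported along `ΓIso`). [folklore] -/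
def fatIdeal : Ideal Γ(line p, ⊤) := (Ideal.span {qPoly p ^ 2}).comap (ΓIso p).symm.toRingHom

/-- Membership in `fatIdeal`, pulled back to `K[x]`. [folklore] -/
private lemma mem_fatIdeal (r : Γ(line p, ⊤)) : r ∈ fatIdeal p ↔ (ΓIso p).symm r ∈ Ideal.span {qPoly p ^ 2} :=
  Ideal.mem_comap

/-- The ideal sheaf of the fat point `X = V((x^p − t)²) ⊂ 𝔸¹_K`. [folklore] -/
def fatPoint : (line p).IdealSheafData := .ofIdealTop (fatIdeal p)

/-- `q = x^p − t` generates a maximal ideal of `K[x]`. [folklore] -/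
private lemma isMaximal_span_qPoly : (Ideal.span {qPoly p}).IsMaximal :=
  PrincipalIdealRing.isMaximal_of_irreducible (irreducible_insepPoly p)

/-- A point of `Spec K[x]` whose prime contains `q` is the point `P = (q)`. [folklore] -/
private lemma eq_insepPoint_of_mem {x : line p} (hx : qPoly p ∈ x.asIdeal) : x = insepPoint p := by
  apply PrimeSpectrum.ext
  exact ((isMaximal_span_qPoly p).eq_of_le x.isPrime.ne_top
    ((Ideal.span_singleton_le_iff_mem _).mpr hx)).symm

/-- `q ∈ P`. [folklore] -/
private lemma qPoly_mem_insepPoint : qPoly p ∈ (insepPoint p).asIdeal := Ideal.mem_span_singleton_self _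

/-- The support of `X = V((x^p − t)²)` is the single closed point `P`. [folklore] -/
private lemma coe_support_fatPoint : ((fatPoint p).support : Set (line p)) = {insepPoint p} := by
  rw [fatPoint, Scheme.IdealSheafData.coe_support_ofIdealTop, Spec_zeroLocus]
  ext x
  simp only [PrimeSpectrum.mem_zeroLocus, Set.subset_def, Set.mem_preimage, SetLike.mem_coe]
  constructor
  · intro hx
    have h2 : qPoly p ^ 2 ∈ x.asIdeal :=
      hx (qPoly p ^ 2) (by rw [mem_fatIdeal, ΓIso_symm_inv_apply]; exact Ideal.mem_span_singleton_self _)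
    exact eq_insepPoint_of_mem p (x.isPrime.mem_of_pow_mem 2 h2)
  · rintro rfl r hr
    rw [mem_fatIdeal, ΓIso_symm_inv_apply] at hr
    exact Ideal.span_singleton_le_span_singleton.mpr (dvd_pow_self _ two_ne_zero) hr

/-- The top affine open of `Z`. [folklore] -/
def topOpen : (line p).affineOpens := ⟨⊤, isAffineOpen_top (line p)⟩

/-- On the affine `Z`, the ideal of sections of `ofIdealTop I` over `⊤` is `I`. [folklore] -/
private lemma ideal_ofIdealTop_topOpen (I : Ideal Γ(line p, ⊤)) :
    (Scheme.IdealSheafData.ofIdealTop I).ideal (topOpen p) = I := by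
  have h := (Scheme.IdealSheafData.equivOfIsAffine (X := line p)).apply_symm_apply I
  rw [Scheme.IdealSheafData.equivOfIsAffine_symm_apply,
    Scheme.IdealSheafData.equivOfIsAffine_apply] at h
  exact h

/-- `q² ∤ q` in `K[x]`. [folklore] -/
private lemma not_sq_dvd_qPoly : ¬ (qPoly p ^ 2 ∣ qPoly p) := by
  intro h
  have hq0 : qPoly p ≠ 0 := (irreducible_insepPoly p).ne_zero
  rw [pow_two] at h
  have h1 : qPoly p * qPoly p ∣ qPoly p * 1 := by simpa using h
  rw [mul_dvd_mul_iff_left hq0] at h1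
  exact (irreducible_insepPoly p).not_isUnit (isUnit_of_dvd_one h1)

/-- `V((x^p − t)²) = Spec K[x]/((x^p − t)²)` is not a regular scheme (it is not even reduced).
[folklore] -/
private theorem not_isRegular_fatPoint : ¬ Scheme.IsRegular (fatPoint p).subscheme := by
  intro hreg
  haveI : IsReduced (fatPoint p).subscheme := hreg.isReduced
  let e := (fatPoint p).subschemeObjIso (topOpen p)
  haveI : _root_.IsReduced Γ((fatPoint p).subscheme, (fatPoint p).subschemeι ⁻¹ᵁ (topOpen p : (line p).Opens)) :=
    IsReduced.component_reduced _
  have hred : _root_.IsReduced (Γ(line p, (topOpen p : (line p).Opens)) ⧸ (fatPoint p).ideal (topOpen p)) :=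
    isReduced_of_injective e.inv.hom e.commRingCatIsoToRingEquiv.symm.injective
  have hI : (fatPoint p).ideal (topOpen p) = fatIdeal p := ideal_ofIdealTop_topOpen p (fatIdeal p)
  have hrad' : ((fatPoint p).ideal (topOpen p)).IsRadical :=
    (Ideal.isRadical_iff_quotient_reduced _).mpr hred
  have hred : (fatIdeal p).IsRadical := hI ▸ hrad'
  have hmem : (ΓIso p (qPoly p)) ^ 2 ∈ fatIdeal p := by
    rw [mem_fatIdeal, map_pow, RingEquiv.symm_apply_apply]
    exact Ideal.mem_span_singleton_self _
  have hmem' : ΓIso p (qPoly p) ∈ fatIdeal p := hred ⟨2, hmem⟩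
  rw [mem_fatIdeal, RingEquiv.symm_apply_apply, Ideal.mem_span_singleton] at hmem'
  exact not_sq_dvd_qPoly p hmem'

/-- **No closed subscheme of `𝔸¹_K` (`K = 𝔽_p(t)`) supported exactly at the point `P = (x^p − t)` is smooth
over `K`.** Its affine ring is `A = K[x]/J` with `√J = (x^p − t)`; if `V(C) → Spec K` were smooth, `A` would be
reduced (Stacks 056T), so `J = (x^p − t)` and `A = K(t^{1/p})` would be a smooth `K`-algebra, whence (base change)
`K(t^{1/p}) ⊗_K K(t^{1/p})` smooth over the field `K(t^{1/p})`, hence reduced — contradicting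
`not_isReduced_extField_tensor` (Liu, Ex. 3.2.12). In particular the REGULAR reduced point `Spec K(t^{1/p}) =
V(x^p − t)` is not smooth over `K` (Liu, Remark 4.3.34: regular ≠ smooth over imperfect fields).
[cite: Liu2002, Example 3.2.12 and Remark 4.3.34] [cite: StacksProject, Tag 056T] -/
theorem not_smooth_of_support_eq (C : (line p).IdealSheafData)
    (hsuppP : (C.support : Set (line p)) = {insepPoint p}) : ¬ Smooth (C.subschemeι ≫ lineToBase p) := by
  intro hsm
  have hsub : (C.support : Set (line p)) ⊆ {insepPoint p} := hsuppP.le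
  have hPmem : insepPoint p ∈ (C.support : Set (line p)) := by rw [hsuppP]; exact Set.mem_singleton _
  -- (b) `C` is the ideal sheaf of its ideal of global sections `J`
  let J : Ideal Γ(line p, ⊤) := C.ideal (topOpen p)
  have hC : C = .ofIdealTop J :=
    ((Scheme.IdealSheafData.equivOfIsAffine (X := line p)).symm_apply_apply C).symm
  have hsuppJ : (C.support : Set (line p)) =
      PrimeSpectrum.zeroLocus ((Scheme.ΓSpecIso (lineRingCat p)).inv ⁻¹' (J : Set Γ(line p, ⊤))) := by
    conv_lhs => rw [hC]
    rw [Scheme.IdealSheafData.coe_support_ofIdealTop, Spec_zeroLocus]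
  have hsupp : ∀ x : line p, x ∈ (C.support : Set (line p)) ↔
      ∀ r : lineRing p, (Scheme.ΓSpecIso (lineRingCat p)).inv r ∈ J → r ∈ x.asIdeal := by
    intro x
    rw [hsuppJ]
    change (Scheme.ΓSpecIso (lineRingCat p)).inv ⁻¹' (J : Set Γ(line p, ⊤)) ⊆ (x.asIdeal : Set (lineRing p)) ↔ _
    simp only [Set.subset_def, Set.mem_preimage, SetLike.mem_coe]
  -- (c) the surjection `g : K[x] → A = Γ(V(C), ⊤)` and its kernel
  haveI : IsAffine C.subscheme := isAffine_of_isAffineHom C.subschemeι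
  let g : lineRing p →+* Γ(C.subscheme, ⊤) := (C.subschemeι.appTop).hom.comp (ΓIso p).toRingHom
  have hg_surj : Function.Surjective g :=
    (C.subschemeι_app_surjective (topOpen p)).comp (ΓIso p).surjective
  have hker : RingHom.ker g = J.comap (ΓIso p).toRingHom := by
    show RingHom.ker ((C.subschemeι.appTop).hom.comp (ΓIso p).toRingHom) = _
    rw [← RingHom.comap_ker]
    congr 1
    exact C.ker_subschemeι_app (topOpen p)
  have hker_le : ∀ x : line p, RingHom.ker g ≤ x.asIdeal ↔ x = insepPoint p := by
    intro x
    rw [hker]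
    constructor
    · intro hle
      have hx : x ∈ (C.support : Set (line p)) := by
        rw [hsupp]
        intro r hr
        exact hle (show (ΓIso p).toRingHom r ∈ J from hr)
      simpa using hsub hx
    · rintro rfl r hr
      exact (hsupp (insepPoint p)).mp hPmem r hr
  -- (d) `A` is a smooth `K`-algebra via `g ∘ algebraMap`, hence reduced; so `ker g` is radical
  have hsmooth : RingHom.Smooth ((C.subschemeι ≫ lineToBase p).appTop).hom :=
    (HasRingHomProperty.iff_of_isAffine (P := @Smooth)).mp hsm
  have hcomp : g.comp (algebraMap (baseField p) (lineRing p)) =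
      ((C.subschemeι ≫ lineToBase p).appTop).hom.comp
        (Scheme.ΓSpecIso (.of (baseField p))).commRingCatIsoToRingEquiv.symm.toRingHom := by
    have hnat := Scheme.ΓSpecIso_inv_naturality (CommRingCat.ofHom (algebraMap (baseField p) (lineRing p)))
    apply RingHom.ext
    intro c
    have := congrArg (fun h => h.hom c) hnat
    simp only [CommRingCat.hom_comp, RingHom.coe_comp, Function.comp_apply, CommRingCat.hom_ofHom] at this
    simp only [g, RingHom.coe_comp, Function.comp_apply, Scheme.Hom.comp_appTop, CommRingCat.hom_comp]
    exact congrArg (C.subschemeι.appTop).hom this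
  have hsmooth' : RingHom.Smooth (g.comp (algebraMap (baseField p) (lineRing p))) := by
    rw [hcomp]
    exact RingHom.Smooth.respectsIso.2 _ _ hsmooth
  haveI hredA : _root_.IsReduced Γ(C.subscheme, ⊤) := by
    letI : Algebra (baseField p) Γ(C.subscheme, ⊤) :=
      (g.comp (algebraMap (baseField p) (lineRing p))).toAlgebra
    haveI : Algebra.Smooth (baseField p) Γ(C.subscheme, ⊤) := hsmooth'
    exact Literature.AlgebraicGeometry.Motives.isReduced_of_smooth_of_field (baseField p) _
  have hrad : (RingHom.ker g).IsRadical := by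
    rw [Ideal.isRadical_iff_quotient_reduced]
    exact isReduced_of_injective (RingHom.kerLift g) (RingHom.kerLift_injective g)
  -- (e) `ker g = (q)`
  have hkerq : RingHom.ker g = Ideal.span {qPoly p} := by
    apply le_antisymm
    · exact (hker_le (insepPoint p)).mpr rfl
    · rw [Ideal.span_singleton_le_iff_mem]
      refine hrad ?_
      rw [Ideal.radical_eq_sInf, Ideal.mem_sInf]
      rintro I ⟨hI, hIp⟩
      have hx : (⟨I, hIp⟩ : PrimeSpectrum (lineRing p)) = insepPoint p := (hker_le ⟨I, hIp⟩).mp hI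
      have := qPoly_mem_insepPoint p
      rw [← hx] at this
      exact this
  -- (f) transport: `K → K[x]/(q) = K(t^{1/p})` is a smooth ring map
  let θ : Γ(C.subscheme, ⊤) ≃+* extField p :=
    (RingHom.quotientKerEquivOfSurjective hg_surj).symm.trans (Ideal.quotEquivOfEq hkerq)
  have hθg : ∀ r : lineRing p, θ (g r) = AdjoinRoot.mk (insepPoly p) r := by
    intro r
    simp only [θ, RingEquiv.trans_apply, RingHom.quotientKerEquivOfSurjective_symm_apply]
    rfl
  have halg : algebraMap (baseField p) (extField p) =
      θ.toRingHom.comp (g.comp (algebraMap (baseField p) (lineRing p))) := by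
    apply RingHom.ext
    intro c
    rw [AdjoinRoot.algebraMap_eq']
    simp only [RingHom.coe_comp, Function.comp_apply, RingEquiv.toRingHom_eq_coe, RingHom.coe_coe]
    rw [hθg]
    rfl
  have hsmoothE : (algebraMap (baseField p) (extField p)).Smooth := by
    rw [halg]
    exact RingHom.Smooth.respectsIso.1 _ _ hsmooth'
  haveI : Algebra.Smooth (baseField p) (extField p) := RingHom.smooth_algebraMap.mp hsmoothE
  -- (g) base change: `K(t^{1/p}) ⊗_K K(t^{1/p})` would be smooth over a field, hence reduced
  haveI : Algebra.Smooth (extField p) (extField p ⊗[baseField p] extField p) := inferInstance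
  exact not_isReduced_extField_tensor p
    (Literature.AlgebraicGeometry.Motives.isReduced_of_smooth_of_field (extField p) _)

end Witness

/-! ## 2. The barrier -/
/-- **Barrier (smooth versus regular centres over an imperfect base field), proved.** For every prime `p`, over
the imperfect field `K = 𝔽_p(t)` the affine line `Z = 𝔸¹_K` (smooth, irreducible) carries the closed subscheme
`X = V((x^p − t)²)`, supported at the single closed point `P = (x^p − t)` with residue field `K(t^{1/p})`, such that
`X` is NOT regular while NO closed subscheme of `Z` supported exactly at `P` is smooth over `K`. Consequently an
embedded-resolution format over an ARBITRARY base field whose blow-up centres must be closed subschemes SMOOTH OVER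
THE BASE FIELD inside the singular locus cannot start on `X ⊂ Z`, although `X_red = Spec K(t^{1/p})` is regular
(«regular … but not smooth over `k`» [cite: Liu2002, Remark 4.3.34]; «reduced but not geometrically reduced»
[cite: Liu2002, Example 3.2.12]; over a perfect field regular = smooth [cite: Liu2002, Cor. 4.3.33]). Mechanism
formalised: a smooth `K`-algebra is reduced [cite: StacksProject, Tag 056T] and stays smooth after base change, while
`K(t^{1/p}) ⊗_K K(t^{1/p})` is not reduced (`not_isReduced_extField_tensor`, companion entry `InseparableBaseChange`).

BARRIER (D-0021):
- technique_class: smooth-centres-over-ground-field embedded-resolution-any-base-field k-smooth-permissible-centre smooth-resolution geometric-regularity imperfect-base-field-scope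
- blocks: (1) embedded resolution of closed subschemes `X` of a smooth `K`-scheme by blow-ups in centres SMOOTH OVER `K` contained in the singular locus, claimed for ARBITRARY `K` of characteristic `p`: for `K = 𝔽_p(t)`, `X = V((x^p − t)²) ⊂ 𝔸¹_K` no admissible centre exists and `X` is not regular (`SmoothVsRegularImperfectBase`, `not_smooth_of_support_eq`, `not_isRegular_fatPoint`); (2) in particular the TYPED as-printed reading of the introduction sentence of the 2017 Hironaka manuscript, p.3 l.4–7 [txt l.5–8] «for an arbitrary algebraic scheme … over any base field 𝕂 of any characteristic p > 0» with p.3 l.17 [txt l.23] «D_j is a closed irreducible smooth subscheme contained in the singular locus of X_j» (`Literature.AlgebraicGeometry.Hironaka2017.S01Introduction.MainClaimAsPrinted`, cell res-hironaka row 020, a CANDIDATE statement under adjudication, D-0012): `hironaka2017_not_mainClaimAsPrinted : ¬ MainClaimAsPrinted.{0}` [claim: Hironaka2017, status: under-review] — recorded by the cell's GAP-LEDGER R46 as «DOES-NOT-FOLLOW-AS-PRINTED, class SCOPE: the Introduction's scope sentence over-states the body's standing convention (smooth vs regular over imperfect fields); not a defect of the mathematics under its convention» (director-resolution 2026-08-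26T20:47:59Z).
- because: Frobenius kills the derivative of `x^p − t`, so the reduced point `P` of `𝔸¹_{𝔽_p(t)}` has purely inseparable residue field `K(t^{1/p})`; a `K`-smooth scheme is geometrically reduced [cite: StacksProject, Tag 056T], but `K(t^{1/p}) ⊗_K K(t^{1/p}) ∋ t^{1/p} ⊗ 1 − 1 ⊗ t^{1/p}` is a non-zero nilpotent [cite: Liu2002, Example 3.2.12]; every closed subscheme supported at `P` that is smooth over `K` would be reduced, i.e. equal to `Spec K(t^{1/p})`, which is not smooth.
- evasions_known: (i) restrict to PERFECT base fields, where regular = smooth for schemes of finite type [cite: Liu2002, Cor. 4.3.33] — the manuscript's own standing convention §2 p.4 l.22–24 («a perfect base field K … we may choose K = ℤ/pℤ»), reading `MainClaimPerfect`, under which the witness disappears (`Spec` of a finite separable extension is étale); (ii) ask the centres to be REGULAR rather than smooth over `K` (Hironaka 2017 Def. 2.4, p.6 [txt l.16] «D_i is a smooth (or only regular) irreducible …»; the printed dimension-three theorems blow up regular centres [cite: CossartPiltant2019, §1 (Thm. 1.1 and the paragraph on ι)]) — then blowing up the reduced point `P` is admissible; (iii) ask only for a non-embedded resolution `X̃ →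 X` with `X̃` REGULAR (the summit's form `Literature.AlgebraicGeometry.Resolution.IsResolution`): `X_red = Spec K(t^{1/p})` is already regular.
- scope_caveats: (a) proved here: the explicit instance for every prime `p` (`K = RatFunc (ZMod p)`, `Z = Spec K[x]`, `X = V((x^p − t)²)`), in Mathlib's scheme language (`AlgebraicGeometry.Smooth`, `Scheme.IdealSheafData.subscheme`, `Literature.AlgebraicGeometry.Resolution.Scheme.IsRegular`); (b) `X` is NOT reduced — the reduced/«algebraic variety» reading (`MainClaimAsPrintedReduced`; reduced witness `V(y(y − x^p + t)) ⊂ 𝔸²_K`, two `K`-smooth branches crossing at a point with residue field `K(t^{1/p})`) is NOT covered by this entry (rev. 1); (c) the Hironaka application refutes the `Type 0` instance of a universe-polymorphic candidate statement and says nothing about the manuscript under its standing convention (`K` perfect), nor about resolution of singularities in characteristic `p`; (d) the entry constrains formats with `K`-SMOOTH centres over imperfect `K` only.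
- status: established
-/
theorem SmoothVsRegularImperfectBase (p : ℕ) [Fact p.Prime] :
    ∃ (K : Type) (_ : Field K) (_ : CharP K p) (Z : Scheme.{0}) (f : Z ⟶ Spec (.of K)) (_ : Smooth f)
      (_ : IrreducibleSpace Z) (X : Z.IdealSheafData) (P : Z),
      (X.support : Set Z) = {P} ∧ ¬ Scheme.IsRegular X.subscheme ∧
        ∀ C : Z.IdealSheafData, (C.support : Set Z) = {P} → ¬ Smooth (C.subschemeι ≫ f) :=
  ⟨baseField p, inferInstance, inferInstance, line p, lineToBase p, inferInstance, inferInstance, fatPoint p,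
    insepPoint p, coe_support_fatPoint p, not_isRegular_fatPoint p, not_smooth_of_support_eq p⟩

/-! ## 3. Application: the typed §1 ERS format of Hironaka 2017 (cell res-hironaka, row 020) -/
section Application
open Literature.AlgebraicGeometry.Hironaka2017.S01Introduction
variable {K : Type u} [Field K] {Z : Scheme.{u}} (f : Z ⟶ Spec (.of K)) (X : Z.IdealSheafData)

/-- In the typed §1 ERS format of the manuscript (p.3 l.10–19 [txt l.11–25], row 020 `IsERSSequence`: centres with
irreducible support inside the singular locus, smooth over `K`): if NO ideal sheaf `C` on `Z` is such a centre for
`X`, every `IsERSSequence f X σ X'` is the empty diagram (`Z' = Z`, `σ = 𝟙`, `X' = X`). A consequence of the typed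
definition only. [claim: Hironaka2017, status: under-review] -/
theorem eq_refl_of_noCentre
    (hno : ∀ C : Z.IdealSheafData, IsIrreducible (C.support : Set Z) → Smooth (C.subschemeι ≫ f) →
      ¬ ((C.support : Set Z) ⊆ singularLocusOf X)) :
    ∀ ⦃Z' : Scheme.{u}⦄ (σ : Z' ⟶ Z) (X' : Z'.IdealSheafData), IsERSSequence f X σ X' →
      ∃ _ : Z' = Z, HEq σ (𝟙 Z) ∧ HEq X' X := by
  intro Z' σ X' h
  induction h with
  | refl => exact ⟨rfl, HEq.rfl, HEq.rfl⟩
  | blowup h C τ hτ hirr hsm hsing ih =>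
    obtain ⟨e, hσ, hX⟩ := ih
    subst e; obtain ⟨⟩ := eq_of_heq hσ; obtain ⟨⟩ := eq_of_heq hX
    simp only [Category.id_comp] at hsm
    exact (hno C hirr hsm hsing).elim

/-- Same format (p.3 l.10–19 [txt l.11–25], row 020 `HasERS`/`IsERS`): with no admissible first centre and `V(X)` not
regular, `X ⊂ Z` has no ERS in the typed sense. A consequence of the typed definition only.
[claim: Hironaka2017, status: under-review] -/
theorem not_hasERS_of_noCentre
    (hno : ∀ C : Z.IdealSheafData, IsIrreducible (C.support : Set Z) → Smooth (C.subschemeι ≫ f) →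
      ¬ ((C.support : Set Z) ⊆ singularLocusOf X))
    (hX : ¬ Scheme.IsRegular X.subscheme) :
    ¬ HasERS f X := by
  rintro ⟨Z', σ, X', hseq, hreg⟩
  obtain ⟨e, -, hX'⟩ := eq_refl_of_noCentre f X hno σ X' hseq
  subst e
  obtain ⟨⟩ := eq_of_heq hX'
  exact hX hreg

variable (p : ℕ) [hp : Fact p.Prime]

/-- The singular locus of `X` lies in the support `{P}` of `X`. [folklore] -/
private lemma singularLocusOf_fatPoint_subset : singularLocusOf (fatPoint p) ⊆ {insepPoint p} := by
  rw [← coe_support_fatPoint, ← Scheme.IdealSheafData.range_subschemeι]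
  exact Set.image_subset_range _ _

/-- No admissible first centre exists for `X = V((x^p − t)²) ⊂ 𝔸¹_{𝔽_p(t)}` in the typed §1 ERS format of the
manuscript (centres with irreducible support inside the singular locus, smooth over `K`). [folklore] -/
private theorem noCentre_fatPoint (C : (line p).IdealSheafData)
    (hirr : IsIrreducible (C.support : Set (line p))) (hsm : Smooth (C.subschemeι ≫ lineToBase p))
    (hsing : (C.support : Set (line p)) ⊆ singularLocusOf (fatPoint p)) : False := by
  have hsub : (C.support : Set (line p)) ⊆ {insepPoint p} := hsing.trans (singularLocusOf_fatPoint_subset p)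
  have hPmem : insepPoint p ∈ (C.support : Set (line p)) := by
    obtain ⟨x, hx⟩ := hirr.nonempty
    have := hsub hx
    rw [Set.mem_singleton_iff] at this
    rwa [this] at hx
  exact not_smooth_of_support_eq p C (hsub.antisymm (Set.singleton_subset_iff.mpr hPmem)) hsm

/-- `X = V((x^p − t)²) ⊂ 𝔸¹_{𝔽_p(t)}` has no ERS in the typed §1 format (p.3 l.10–19 [txt l.11–25], row 020 `HasERS`,
p458552), for every prime `p`. [claim: Hironaka2017, status: under-review] -/
theorem not_hasERS_fatPoint : ¬ HasERS (lineToBase p) (fatPoint p) :=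
  not_hasERS_of_noCentre (lineToBase p) (fatPoint p) (noCentre_fatPoint p) (not_isRegular_fatPoint p)

/-- **Application (cell res-hironaka, GAP-LEDGER R46 / R25, artefact A-46-1): the §1 existence sentence of the
Hironaka 2017 manuscript read AS PRINTED («over any base field K»; `S01Introduction.MainClaimAsPrinted`, a CANDIDATE
statement, row 020 p458552) is false AS TYPED** (instance `p = 2` of `not_hasERS_fatPoint`). Verdict class SCOPE
(director-resolution 2026-08-26T20:47:59Z): the introduction's scope words over-state the body's standing convention
§2 p.4 («K perfect», reading `MainClaimPerfect`), under which this witness does not exist; nothing here bears on the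
manuscript under its convention. [claim: Hironaka2017, status: under-review] -/
theorem hironaka2017_not_mainClaimAsPrinted : ¬ MainClaimAsPrinted.{0} := by
  intro h
  haveI : Fact (Nat.Prime 2) := ⟨Nat.prime_two⟩
  exact not_hasERS_fatPoint 2 (h 2 Nat.prime_two (baseField 2) (line 2) (lineToBase 2) (fatPoint 2))

end Application

end Literature.Barriers.ResolutionOfSingularities

end
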